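import Summits.Parity.GeneralizedHardyLittlewood.Theses.LeeYangFibres
import Summits.Parity.GeneralizedHardyLittlewood.Theorems.LeeYangFibresAbsoluteUpgradeDefs
import Summits.Parity.GeneralizedHardyLittlewood.Theorems.LeeYangFibresAbsoluteUpgradeCellsToDimOneAux
import Summits.Parity.GeneralizedHardyLittlewood.Theorems.LeeYangFibresCellsToRelativeDimOneCounts
import Summits.Parity.GeneralizedHardyLittlewood.Theorems.LeeYangFibresAbsoluteUpgradeSingularProductLogLog
import Summits.Parity.GeneralizedHardyLittlewood.Theorems.LeeYangFibresAbsoluteUpgradeSlices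
import Summits.Parity.GeneralizedHardyLittlewood.Theorems.LeeYangFibresCellParityLawSingularRatio
import HarnessLib

/-!
# Route `LeeYangFibres`, crux `AbsoluteUpgrade` (stmt-Parity-14116), line `nlc-cells-absolute-clip`:
# the registered stub `stub_cellsToDimOne : PrimeCellsAbsolute → DimOne`

Partial summation WITH A RATE: the absolute prime-cell asymptotic
`C = M (A₁/N)^t ± ε N / log^t N` (`C` = number of `n ∈ K ∩ [-N, N] ∩ ℤ` all of whose values
`ψ_i(n)` are primes `> N^{1/u}`, `M = β_∞ ∏_p β_p`, `A₁ = π(N) - π(N^{1/u})`) at some roughness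
`u = u(N) ≥ 2` implies the `Λ`-weighted `d = 1` statement `DimOne` with absolute error `ε N`.

This is the absolute analogue of the route's proved support `CellsToRelativeDimOne`
(`Theorems/LeeYangFibresCellsToRelativeDimOne`, whose count helpers in `…Counts` are reused).  The
difference: `M` may be as large as `G N`, `G = (2 C(t, L) + 1) (log log N)^{t-1}`
(`stub_singularProduct_le_loglog_pow`, `archFactor_le_two_mul`, `singularProduct_nonneg`), so
every MULTIPLICATIVE distortion must be `o(1/G)`:
* the sandwich `vonMangoldtSum_primePointCount_sandwich` is run at threshold `Y = N / log^{t+1} N`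
  with `a = (1 - η) log N`, `b = (1 + η) log N`, `η = ((t+1) log log N + log 2L) / log N`, so the
  distortion `(1 ± η)^t = 1 ± 2 t η` (`pow_near_one`) costs `2 t η M ≤ ε N / 4`;
* `κ = (A₁ log N / N)^t = 1 ± O(t (C_π + 1)/log N)` by the prime number theorem WITH RATE
  (`exists_primeCounting_rate`), costing `|M κ - M| ≤ ε N / 8` (`mainTerm_window`);
* the three error counts cost `≤ ε N / 16` (`errorCounts_le`) and the cell error contributes
  `log^t N · (ε/8) N / log^t N = ε N / 8`; `cells_arith_abs` adds up to `≤ ε N`.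
The helpers live in `LeeYangFibresAbsoluteUpgradeCellsToDimOneAux`.

References: B. Green, T. Tao, *Linear equations in primes*, Ann. of Math. 171 (2010), Conj. 1.2 and
the sketch proof of Conj. 1.4 after (1.8) [GreenTao2010]; H. L. Montgomery, R. C. Vaughan,
*Multiplicative Number Theory I* (2007), Theorem 6.9 [MontgomeryVaughan2007].
-/

noncomputable section

namespace Summit.Parity.GeneralizedHardyLittlewood.Theorems.AbsoluteUpgrade

open Filter Finset Asymptotics
open scoped Topology
open Literature.NumberTheory.Sieve Literature.NumberTheory.LFunctions
open Summit.Parity.GeneralizedHardyLittlewood.Theses.LeeYangFibres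
open Summit.Parity.GeneralizedHardyLittlewood.Cruxes.AbsoluteUpgrade.NlcCellsAbsoluteClip
open Summit.Parity.GeneralizedHardyLittlewood.Theorems.LeeYangFibresCells
open Summit.Parity.GeneralizedHardyLittlewood.Cruxes.CellParityLaw.SectionAnnihilator.SingularRatio
  (singularProduct_nonneg)

/-! ### One scale -/

/-- **Main step at one scale `N` (absolute form).** Under the growth conditions on `ℓ = log N`
listed as hypotheses (all eventually true for fixed `t, L, ε, c₂, C_π` and
`G = G₀ (log log N)^{t-1}`), the comparison `C ≤ P ≤ C + t(2N^{1/u}+1)` of the cell count `Cn`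
with the prime-point count, the window `π(N) - N^{1/u} ≤ A₁ ≤ π(N)`, the prime number theorem
with rate `|π(N) ℓ - N| ≤ C_π N/ℓ`, the mass bound `0 ≤ M ≤ G N` and the ABSOLUTE cell
asymptotic `|Cn - M (A₁/N)^t| ≤ (ε/8) N/ℓ^t`, one has `|∑ ∏ Λ(ψᵢ(n)) - M| ≤ ε N`.
[cite: GreenTao2010, Conj. 1.4 (sketch proof)] -/
theorem abs_vonMangoldtSum_sub_le_abs_of_cells {t L N u : ℕ} {ε c₂ G Cπ Cn A₁ M : ℝ}
    (Ψ : Fin t → AffLinForm 1) (K : Set (Fin 1 → ℝ)) (ht : 1 ≤ t) (hN3 : 3 ≤ N) (hu2 : 2 ≤ u)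
    (hε : 0 < ε) (hε1 : ε ≤ 1) (hΨ : IsNondegenerateSystem Ψ) (hL : affLinSize Ψ N ≤ L)
    (hc₂0 : 0 < c₂) (hc₂ : 12 * t * (Real.sqrt (2 * L) + 1) * c₂ ≤ ε / 16)
    (hℓt : 144 * t ≤ ε * Real.log N) (hℓpow : Real.log N ^ (t + 1) ≤ 1 * N)
    (hℓsqrt : Real.log N ^ (t + 1) ≤ c₂ * Real.sqrt N)
    (hG1 : 1 ≤ G) (hM0 : 0 ≤ M) (hMG : M ≤ G * N)
    (hdist : 8 * t * ((t + 1) * Real.log (Real.log N) + Real.log (2 * L)) * G ≤ ε * Real.log N)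
    (hCπ : 0 ≤ Cπ) (hπ : |(Nat.primeCounting N : ℝ) * Real.log N - N| ≤ Cπ * N / Real.log N)
    (hkap : 16 * t * (Cπ + 1) * G ≤ ε * Real.log N)
    (hPCA : |Cn - M * (A₁ / N) ^ t| ≤ ε / 8 * N / Real.log N ^ t)
    (hC1 : Cn ≤ primePointCount Ψ K N)
    (hC2 : (primePointCount Ψ K N : ℝ) ≤ Cn + t * (2 * (N : ℝ) ^ ((1 : ℝ) / u) + 1))
    (hA1 : (Nat.primeCounting N : ℝ) ≤ A₁ + (N : ℝ) ^ ((1 : ℝ) / u))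
    (hA2 : A₁ ≤ Nat.primeCounting N) :
    |vonMangoldtSum Ψ K N - M| ≤ ε * N := by
  have hN1 : 1 ≤ N := by omega
  have hx3 : (3 : ℝ) ≤ N := by exact_mod_cast hN3
  have hx0 : (0 : ℝ) < N := by linarith
  have ht1 : (1 : ℝ) ≤ t := by exact_mod_cast ht
  have hℓ1 : 1 < Real.log N := by
    rw [Real.lt_log_iff_exp_lt hx0]
    linarith [Real.exp_one_lt_d9]
  set ℓ : ℝ := Real.log N with hℓdef
  have hℓ0 : 0 < ℓ := by linarith
  set T : ℝ := ℓ ^ t with hTdef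
  have hT : 0 < T := pow_pos hℓ0 t
  have hℓt1 : 0 < ℓ ^ (t + 1) := pow_pos hℓ0 _
  obtain ⟨i₀⟩ : Nonempty (Fin t) := ⟨⟨0, ht⟩⟩
  have hL1 : (1 : ℝ) ≤ L := one_le_of_affLinSize_le Ψ hΨ hL i₀
  have hlog2L : 0 ≤ Real.log (2 * L) := Real.log_nonneg (by linarith)
  have hlogℓ : 0 ≤ Real.log ℓ := Real.log_nonneg hℓ1.le
  have hεN : 0 ≤ ε * N := by positivity
  -- the distortion `η = ((t+1) log ℓ + log 2L) / ℓ` and `δ = 2 t η ≤ ε / (4 G)`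
  set η : ℝ := ((t + 1) * Real.log ℓ + Real.log (2 * L)) / ℓ with hηdef
  have hηℓ : η * ℓ = (t + 1) * Real.log ℓ + Real.log (2 * L) := div_mul_cancel₀ _ hℓ0.ne'
  have hη0 : 0 ≤ η := div_nonneg (by positivity) hℓ0.le
  have hηG : 8 * t * η * G ≤ ε := by
    have h1 : 8 * t * η * G * ℓ ≤ ε * ℓ := by
      calc 8 * t * η * G * ℓ = 8 * t * (η * ℓ) * G := by ring
        _ = 8 * t * ((t + 1) * Real.log ℓ + Real.log (2 * L)) * G := by rw [hηℓ]
        _ ≤ ε * ℓ := hdist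
    exact le_of_mul_le_mul_right h1 hℓ0
  have htη : t * η ≤ 1 / 8 := by
    have h1 : t * η * 1 ≤ t * η * G := mul_le_mul_of_nonneg_left hG1 (by positivity)
    linarith only [h1, hηG, hε1]
  have hη1 : η ≤ 1 / 8 := by
    have : 1 * η ≤ t * η := mul_le_mul_of_nonneg_right ht1 hη0
    linarith only [this, htη]
  set δ : ℝ := 2 * t * η with hδdef
  have hδ0 : 0 ≤ δ := by positivity
  have hδ1 : δ ≤ 1 := by linarith only [hδdef, htη]
  have hδG : δ * G ≤ ε / 4 := by
    have : δ * G = (8 * t * η * G) / 4 := by rw [hδdef]; ring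
    linarith only [this, hηG]
  obtain ⟨hpow_hi, hpow_lo⟩ :=
    pow_near_one t hη0 (by linarith only [hη1]) (by linarith only [htη])
  -- the threshold `Y = N / ℓ^{t+1}` and the sandwich
  set Y : ℝ := N / ℓ ^ (t + 1) with hYdef
  have hY1 : 1 ≤ Y := by
    rw [hYdef, le_div_iff₀ hℓt1, one_mul]
    linarith only [hℓpow]
  have hlogY : (1 - η) * ℓ ≤ Real.log Y := by
    rw [hYdef, Real.log_div hx0.ne' hℓt1.ne', Real.log_pow, ← hℓdef]
    push_cast
    linarith only [hηℓ, hlog2L]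
  have ha0' : 0 ≤ (1 - η) * ℓ := mul_nonneg (by linarith only [hη1]) hℓ0.le
  have hb : Real.log (2 * L * N) ≤ (1 + η) * ℓ := by
    rw [Real.log_mul (by positivity) hx0.ne', ← hℓdef]
    have : 0 ≤ (t + 1 : ℝ) * Real.log ℓ := by positivity
    linarith only [this, hηℓ]
  have hb2 : Real.log (2 * L * N) ≤ 2 * ℓ := by
    have : η * ℓ ≤ 1 * ℓ := mul_le_mul_of_nonneg_right (by linarith only [hη1]) hℓ0.le
    linarith only [hb, this]
  obtain ⟨g, β, γ, hg, hβ, hγ, hS1, hS2, hP1, hP2, hβle, hγle⟩ :=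
    vonMangoldtSum_primePointCount_sandwich hN1 Ψ hΨ hL K ht hY1 ha0' hlogY hb
  simp only [Nat.sub_self, pow_zero, mul_one] at hβle hγle
  -- `c₂ ≤ 1`, hence `ℓ² ≤ √N` and `ℓ √N ≤ N / ℓ`
  have hs0 : 0 < Real.sqrt (N : ℝ) := Real.sqrt_pos.mpr hx0
  have hsL0 : 0 ≤ Real.sqrt (2 * (L : ℝ)) := Real.sqrt_nonneg _
  have hc₂1 : c₂ ≤ 1 := by
    have h1 : 12 * c₂ ≤ 12 * t * (Real.sqrt (2 * L) + 1) * c₂ := by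
      refine mul_le_mul_of_nonneg_right ?_ hc₂0.le
      have h2 : (12 : ℝ) * 1 ≤ 12 * t := by linarith only [ht1]
      have h3 : 12 * (t : ℝ) * 1 ≤ 12 * t * (Real.sqrt (2 * L) + 1) :=
        mul_le_mul_of_nonneg_left (by linarith only [hsL0]) (by positivity)
      linarith only [h2, h3]
    linarith only [h1, hc₂, hε1]
  have hsℓ : Real.sqrt N * ℓ ≤ N / ℓ := by
    have hℓ2s : ℓ * ℓ ≤ Real.sqrt N := by
      calc ℓ * ℓ = ℓ ^ 2 := (sq ℓ).symm
        _ ≤ ℓ ^ (t + 1) := pow_le_pow_right₀ hℓ1.le (by omega)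
        _ ≤ c₂ * Real.sqrt N := hℓsqrt
        _ ≤ 1 * Real.sqrt N := mul_le_mul_of_nonneg_right hc₂1 hs0.le
        _ = Real.sqrt N := one_mul _
    rw [le_div_iff₀ hℓ0]
    calc Real.sqrt N * ℓ * ℓ = Real.sqrt N * (ℓ * ℓ) := by ring
      _ ≤ Real.sqrt N * Real.sqrt N := mul_le_mul_of_nonneg_left hℓ2s hs0.le
      _ = N := Real.mul_self_sqrt hx0.le
  -- `E₂`: the main-term window `|M κ - M| ≤ ε N / 8`, `κ = (A₁ ℓ / N)^t`
  set κ : ℝ := (A₁ / N) ^ t * T with hκdef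
  have hE2 : |M * κ - M| ≤ ε / 8 * N :=
    mainTerm_window ht hN3 hu2 hε hε1 hG1 hM0 hMG hCπ hπ hkap hsℓ hA1 hA2
  -- `E₁`: the cell asymptotic rescaled by `T = ℓ^t`
  have hE1 : |T * Cn - M * κ| ≤ ε / 8 * N := by
    have h1 := mul_le_mul_of_nonneg_left hPCA hT.le
    have h2 : T * |Cn - M * (A₁ / N) ^ t| = |T * Cn - M * κ| := by
      rw [← abs_of_pos hT, ← abs_mul, abs_of_pos hT]
      congr 1
      rw [hκdef]
      ring
    have h3 : T * (ε / 8 * N / ℓ ^ t) = ε / 8 * N := by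
      rw [hTdef]
      field_simp
    rw [h2, h3] at h1
    exact h1
  -- `E₃`: the three error counts
  have hE3 : T * β + T * γ + T * (t * (2 * (N : ℝ) ^ ((1 : ℝ) / u) + 1)) ≤ ε / 16 * N :=
    errorCounts_le ht hN3 hu2 hε hc₂0 hc₂ hℓt hℓpow hℓsqrt hb2 hβle hγle
  -- the sandwich rescaled to `(1 ± δ) T` and the arithmetic heart
  have hlo : (1 - δ) * T ≤ ((1 - η) * ℓ) ^ t := by
    rw [mul_pow]
    refine mul_le_mul_of_nonneg_right ?_ hT.le
    have : 0 ≤ (t : ℝ) * η := by positivity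
    linarith only [this, hpow_lo, hδdef]
  have hhi : ((1 + η) * ℓ) ^ t ≤ (1 + δ) * T := by
    rw [mul_pow]
    exact mul_le_mul_of_nonneg_right (by linarith only [hpow_hi, hδdef]) hT.le
  have hS1' : (1 - δ) * (T * g) ≤ vonMangoldtSum Ψ K N := by
    calc (1 - δ) * (T * g) = (1 - δ) * T * g := by ring
      _ ≤ ((1 - η) * ℓ) ^ t * g := mul_le_mul_of_nonneg_right hlo hg
      _ ≤ _ := hS1
  have hS2' : vonMangoldtSum Ψ K N ≤ (1 + δ) * (T * g + T * β + T * γ) := by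
    calc vonMangoldtSum Ψ K N ≤ ((1 + η) * ℓ) ^ t * (g + β + γ) := hS2
      _ ≤ (1 + δ) * T * (g + β + γ) :=
          mul_le_mul_of_nonneg_right hhi (by linarith only [hg, hβ, hγ])
      _ = (1 + δ) * (T * g + T * β + T * γ) := by ring
  have hG1' : T * Cn - T * β ≤ T * g := by
    have h1 : Cn - β ≤ g := by linarith only [hC1, hP2]
    have h2 := mul_le_mul_of_nonneg_left h1 hT.le
    linarith only [h2]
  have hG2' : T * g ≤ T * Cn + T * (t * (2 * (N : ℝ) ^ ((1 : ℝ) / u) + 1)) := by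
    have h1 : g ≤ Cn + t * (2 * (N : ℝ) ^ ((1 : ℝ) / u) + 1) := by linarith only [hP1, hC2]
    have h2 := mul_le_mul_of_nonneg_left h1 hT.le
    linarith only [h2]
  have key := cells_arith_abs hδ0 hδ1 hM0 (mul_nonneg hT.le hβ) (mul_nonneg hT.le hγ)
    (by positivity) hS1' hS2' hG1' hG2' hE1 hE2 hE3
  have hδM : δ * M ≤ ε / 4 * N := by
    calc δ * M ≤ δ * (G * N) := mul_le_mul_of_nonneg_left hMG hδ0
      _ = δ * G * N := by ring
      _ ≤ ε / 4 * N := mul_le_mul_of_nonneg_right hδG hx0.le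
  linarith only [key, hδM, hεN]

/-! ### The stub -/

/-- **`stub_cellsToDimOne`** (line `nlc-cells-absolute-clip` of crux stmt-Parity-14116):
`PrimeCellsAbsolute → DimOne` — the absolute prime-cell asymptotic at some roughness
`u(N) ≥ 2` implies the `Λ`-weighted `d = 1` Dickson–Hardy–Littlewood statement with absolute
error `ε N`, uniformly over nondegenerate systems of size `≤ L` and convex `K ⊆ [-N, N]`, by
partial summation with a rate (`abs_vonMangoldtSum_sub_le_abs_of_cells`) against
`∏_p β_p ≤ C(t, L) (log log N)^{t-1}` (`stub_singularProduct_le_loglog_pow`) and `β_∞ ≤ 2N`.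
[cite: GreenTao2010, Conj. 1.2] -/
theorem stub_cellsToDimOne : PrimeCellsAbsolute → DimOne := by
  intro hPCA t L ht ε hε
  -- precision bookkeeping
  set ε₀ : ℝ := min ε 1 with hε₀def
  have hε₀ : 0 < ε₀ := lt_min hε one_pos
  have hε₀1 : ε₀ ≤ 1 := min_le_right _ _
  have hε₀ε : ε₀ ≤ ε := min_le_left _ _
  have ht0 : (0 : ℝ) < t := by exact_mod_cast ht
  -- the singular-product bound (S1), the prime number theorem with rate, the cells at `ε₀ / 8`
  obtain ⟨CS, hCS, N₁, hN₁⟩ := stub_singularProduct_le_loglog_pow t L ht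
  obtain ⟨Cπ, hCπ, hπev⟩ := exists_primeCounting_rate
  obtain ⟨N₂, hN₂⟩ := Filter.eventually_atTop.mp hπev
  obtain ⟨N₃, hN₃⟩ := hPCA t L ht (ε₀ / 8) (by positivity)
  -- growth conditions on the scale
  have hden : (0 : ℝ) < 12 * t * (Real.sqrt (2 * L) + 1) := by positivity
  set c₂ : ℝ := ε₀ / 16 / (12 * t * (Real.sqrt (2 * L) + 1)) with hc₂def
  have hc₂0 : 0 < c₂ := div_pos (by positivity) hden
  have hc₂ : 12 * t * (Real.sqrt (2 * L) + 1) * c₂ ≤ ε₀ / 16 := by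
    rw [hc₂def, mul_div_cancel₀ _ hden.ne']
  obtain ⟨N₄, hN₄⟩ := Filter.eventually_atTop.mp
    (eventually_log_growth t (144 * t / ε₀) one_pos one_pos hc₂0)
  set G₀ : ℝ := 2 * CS + 1 with hG₀def
  obtain ⟨N₅, hN₅⟩ := Filter.eventually_atTop.mp
    (eventually_loglog (t - 1) (8 * t * (t + 1) * G₀) (8 * t * Real.log (2 * L) * G₀) hε₀)
  obtain ⟨N₆, hN₆⟩ := Filter.eventually_atTop.mp
    (eventually_loglog (t - 1) 0 (16 * t * (Cπ + 1) * G₀) hε₀)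
  refine ⟨max (max (max N₁ N₂) (max N₃ N₄)) (max (max N₅ N₆) 3),
    fun N hN Ψ hΨ hL K hK hKN => ?_⟩
  have h14 := le_of_max_le_left hN
  have h56 := le_of_max_le_right hN
  have hNN₁ : N₁ ≤ N := le_of_max_le_left (le_of_max_le_left h14)
  have hNN₂ : N₂ ≤ N := le_of_max_le_right (le_of_max_le_left h14)
  have hNN₃ : N₃ ≤ N := le_of_max_le_left (le_of_max_le_right h14)
  have hNN₄ : N₄ ≤ N := le_of_max_le_right (le_of_max_le_right h14)
  have hNN₅ : N₅ ≤ N := le_of_max_le_left (le_of_max_le_left h56)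
  have hNN₆ : N₆ ≤ N := le_of_max_le_right (le_of_max_le_left h56)
  have hN3 : 3 ≤ N := le_of_max_le_right h56
  have hx0 : (0 : ℝ) < N := by
    have : (3 : ℝ) ≤ N := by exact_mod_cast hN3
    linarith
  -- the cells at this scale
  obtain ⟨u, hu2, hcells⟩ := hN₃ N hNN₃
  have hcell := hcells Ψ hΨ hL K hK hKN
  simp only [jointCell, modelCell, roughCell, Finset.prod_const, Finset.card_univ,
    Fintype.card_fin] at hcell
  -- the singular mass `0 ≤ M ≤ G N`, `G = (2 C_S + 1) (log log N)^{t-1}`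
  have hS0 : 0 ≤ singularProduct Ψ := singularProduct_nonneg hΨ
  have hAF0 : 0 ≤ archFactor Ψ K := ENNReal.toReal_nonneg
  have hAF2 : archFactor Ψ K ≤ 2 * (N : ℝ) := archFactor_le_two_mul Ψ hKN
  have hSP := hN₁ N hNN₁ Ψ hΨ hL
  obtain ⟨hll1, hdist0⟩ := hN₅ N hNN₅
  obtain ⟨-, hkap0⟩ := hN₆ N hNN₆
  set Λ : ℝ := Real.log (Real.log N) with hΛdef
  have hΛp : 1 ≤ Λ ^ (t - 1) := one_le_pow₀ hll1
  have hG₀1 : 1 ≤ G₀ := by rw [hG₀def]; linarith only [hCS]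
  have hG₀2 : 2 * CS ≤ G₀ := by rw [hG₀def]; linarith only
  set G : ℝ := G₀ * Λ ^ (t - 1) with hGdef
  have hG1 : 1 ≤ G := by
    rw [hGdef]
    exact one_le_mul_of_one_le_of_one_le hG₀1 hΛp
  have hMG : archFactor Ψ K * singularProduct Ψ ≤ G * N := by
    calc archFactor Ψ K * singularProduct Ψ ≤ (2 * (N : ℝ)) * (CS * Λ ^ (t - 1)) :=
          mul_le_mul hAF2 hSP hS0 (by positivity)
      _ = (2 * CS) * Λ ^ (t - 1) * N := by ring
      _ ≤ G₀ * Λ ^ (t - 1) * N :=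
          mul_le_mul_of_nonneg_right (mul_le_mul_of_nonneg_right hG₀2 (by positivity)) hx0.le
  have hdist : 8 * t * ((t + 1) * Λ + Real.log (2 * L)) * G ≤ ε₀ * Real.log N := by
    calc 8 * t * ((t + 1) * Λ + Real.log (2 * L)) * G
        = (8 * t * (t + 1) * G₀ * Λ + 8 * t * Real.log (2 * L) * G₀) * Λ ^ (t - 1) := by
          rw [hGdef]; ring
      _ ≤ ε₀ * Real.log N := hdist0
  have hkap : 16 * t * (Cπ + 1) * G ≤ ε₀ * Real.log N := by
    calc 16 * t * (Cπ + 1) * G = (0 * Λ + 16 * t * (Cπ + 1) * G₀) * Λ ^ (t - 1) := by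
          rw [hGdef]; ring
      _ ≤ ε₀ * Real.log N := hkap0
  obtain ⟨hCℓ, -, hℓpow, hℓsqrt⟩ := hN₄ N hNN₄
  have hℓt : 144 * t ≤ ε₀ * Real.log N := by
    rw [div_le_iff₀ hε₀] at hCℓ
    linarith only [hCℓ]
  have hZ0 : 0 ≤ (N : ℝ) ^ ((1 : ℝ) / u) := by positivity
  have key := abs_vonMangoldtSum_sub_le_abs_of_cells Ψ K ht hN3 hu2 hε₀ hε₀1 hΨ hL hc₂0 hc₂ hℓt
    hℓpow hℓsqrt hG1 (mul_nonneg hAF0 hS0) hMG hdist hCπ (hN₂ N hNN₂) hkap hcell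
    (card_cells_le_primePointCount N _ Ψ K)
    (primePointCount_le_card_cells_add hZ0 Ψ hΨ K) (primeCounting_le_card_roughPrimes_add N hZ0)
    (card_roughPrimes_le_primeCounting N _)
  calc |vonMangoldtSum Ψ K N - archFactor Ψ K * singularProduct Ψ| ≤ ε₀ * N := key
    _ ≤ ε * N := mul_le_mul_of_nonneg_right hε₀ε (Nat.cast_nonneg _)

end Summit.Parity.GeneralizedHardyLittlewood.Theorems.AbsoluteUpgrade

end
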